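import Summits.CriticalPhenomena.PercolationContinuityZ3.Theorems.Transplant.CayleySkeletonConn
import HarnessLib

/-!
# Abelian groups: the unit cylinder of EVERY unit-range generating system is connected (`CayleySign₂.ofComm`)

builds on p205010 (kernel theorem, internal audit signed; external expert review pending).
Lane `prim-bschramm`, seat `prim-bschramm-p4` gen 11 (PART C3 of `P4-GENERAL.md`, "thick frames").  Helper file
(`--supports stmt-CriticalPhenomena-4575 --as helper`).

`CayleySign.ofComm` (gen 9, file `CayleySkeletonAbelian`) needs `ker φ = ⟨S ∩ ker φ⟩`.  For an ABELIAN group this hypothesis is superfluous: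
`CylBase.boxWalks_of_comm` — if `S` generates, every `k ∈ ker φ` is joined to `1` inside `‖φ‖_∞ ≤ 1` (walk the letters of any word for `k`,
steering back to height `0` after each letter by `s₁^{∓1} s₀^{∓1}`; the steering letters cancel because the group is abelian and `φ k = 0`).
Hence **`CayleySign₂.ofComm`** from: `φ` additive of unit range with unit steps, `S = S⁻¹` generating, ONE automorphism `κ` permuting `S`
with `φκ = diag(1,−1)φ` (`ν` = inversion), and **`CayleySign₂.theta_eq_zero_of_le_ofComm`: `θ_g(p) = 0` for all `p ≤ p_c`** on every such
abelian Cayley graph — no kernel-letter condition.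
-/

noncomputable section

namespace Summit.CriticalPhenomena.PercolationContinuityZ3.Theorems.Transplant

open SimpleGraph Walk Literature.Probability.LatticeModels Literature.Probability.Percolation
open scoped Classical

namespace CayCyl

namespace CylBase

variable {Γ : Type} [CommGroup Γ] {S : Finset Γ} (B : CylBase Γ S)

/-- A step by `t^e`, `|e| ≤ 1`, `t ∈ S`: a walk `g → g t^e` whose vertices are `g` and `g t^e` only. [folklore] -/
theorem exists_walk_unit_zpow {t : Γ} (ht : t ∈ S) (ht1 : t ≠ 1) (g : Γ) (e : ℤ) (he : -1 ≤ e ∧ e ≤ 1) :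
    ∃ w : (mulCayley (S : Set Γ)).Walk g (g * t ^ e), ∀ z ∈ w.support, z = g ∨ z = g * t ^ e := by
  rcases (show e = 0 ∨ e = 1 ∨ e = -1 by omega) with rfl | rfl | rfl
  · refine ⟨(Walk.nil : (mulCayley (S : Set Γ)).Walk g g).copy rfl (by rw [zpow_zero, mul_one]), fun z hz => ?_⟩
    rw [support_copy, support_nil, List.mem_singleton] at hz; exact Or.inl hz
  · refine ⟨(Walk.cons (adj_mul_of_mem S (Or.inl ht) ht1 g) Walk.nil).copy rfl (by rw [zpow_one]), fun z hz => ?_⟩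
    rw [support_copy, support_cons, support_nil, List.mem_cons, List.mem_singleton] at hz
    rcases hz with rfl | rfl
    · exact Or.inl rfl
    · exact Or.inr (by rw [zpow_one])
  · refine ⟨(Walk.cons (adj_mul_of_mem S (t := t⁻¹) (Or.inr (by rw [inv_inv]; exact ht)) (inv_ne_one.2 ht1) g) Walk.nil).copy rfl
      (by rw [zpow_neg, zpow_one]), fun z hz => ?_⟩
    rw [support_copy, support_cons, support_nil, List.mem_cons, List.mem_singleton] at hz
    rcases hz with rfl | rfl
    · exact Or.inl rfl
    · exact Or.inr (by rw [zpow_neg, zpow_one])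

/-- In an abelian group, `proj (x y) = proj x · proj y`. [folklore] -/
theorem proj_mul_comm (x y : Γ) : B.proj (x * y) = B.proj x * B.proj y := by
  simp only [proj, B.map_mul, Pi.add_apply, neg_add, zpow_add]
  ac_rfl

/-- In an abelian group, `proj x⁻¹ = (proj x)⁻¹`. [folklore] -/
theorem proj_inv_comm (x : Γ) : B.proj x⁻¹ = (B.proj x)⁻¹ := by
  simp only [proj, B.φ_inv, Pi.neg_apply, neg_neg, mul_inv, zpow_neg, inv_inv]

/-- **A letter followed by steering**: `1 → s → s s₁^{−φ₁ s} → proj s`, inside the unit box. [folklore] -/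
theorem exists_walk_proj_letter {s : Γ} (hs : s ∈ S) : ∃ w : (mulCayley (S : Set Γ)).Walk (1 : Γ) (B.proj s), B.InBox 1 w := by
  have h1 : B.φ 1 = 0 := B.φ_one
  have hsb : ∀ i, -1 ≤ B.φ s i ∧ B.φ s i ≤ 1 := fun i => by have := B.lip s hs i; rw [abs_le] at this; exact this
  by_cases hs1 : s = 1
  · subst hs1
    refine ⟨(Walk.nil : (mulCayley (S : Set Γ)).Walk (1 : Γ) 1).copy rfl (B.proj_of_ker h1).symm, fun z hz => ?_⟩
    rw [support_copy, support_nil, List.mem_singleton] at hz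
    rw [hz, h1]; exact zero_mem_box 2 1
  have hb := hsb 1; have ha := hsb 0
  obtain ⟨w₂, hw₂⟩ := exists_walk_unit_zpow B.s₁_mem B.s₁_ne_one s (-(B.φ s 1)) (by omega)
  obtain ⟨w₃, hw₃⟩ := exists_walk_unit_zpow B.s₀_mem B.s₀_ne_one (s * B.s₁ ^ (-(B.φ s 1))) (-(B.φ s 0)) (by omega)
  have e₂ : B.φ (s * B.s₁ ^ (-(B.φ s 1))) 0 = B.φ s 0 ∧ B.φ (s * B.s₁ ^ (-(B.φ s 1))) 1 = 0 := by
    rw [B.map_mul, B.φ_zpow, B.φ_s₁]; constructor <;> simp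
  have e₃ : B.φ (s * B.s₁ ^ (-(B.φ s 1)) * B.s₀ ^ (-(B.φ s 0))) = 0 := by
    have := B.φ_proj s; rwa [proj] at this
  refine ⟨(Walk.cons (adj_mul_of_mem S (Or.inl hs) hs1 1) (((w₂.append w₃).copy (one_mul s).symm rfl))).copy rfl (by rw [proj]),
    fun z hz => ?_⟩
  rw [support_copy, support_cons, List.mem_cons, support_copy, support_append, List.mem_append] at hz
  rw [mem_box, Fin.forall_fin_two]
  push_cast
  rcases hz with rfl | hz | hz
  · rw [h1]; simp
  · rcases hw₂ z hz with rfl | rfl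
    · exact ⟨hsb 0, hsb 1⟩
    · rw [e₂.1, e₂.2]; exact ⟨ha, by norm_num⟩
  · rcases hw₃ z (List.tail_subset _ hz) with rfl | rfl
    · rw [e₂.1, e₂.2]; exact ⟨ha, by norm_num⟩
    · rw [e₃]; simp

/-- **ABELIAN GROUPS: every kernel element is joined to `1` inside the unit cylinder** (`S` generating), so `C_1` is connected. [folklore] -/
theorem boxWalks_of_comm (hS : Subgroup.closure (S : Set Γ) = ⊤) (k : Γ) (hk : B.φ k = 0) :
    ∃ w : (mulCayley (S : Set Γ)).Walk (1 : Γ) k, B.InBox 1 w := by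
  have tr : ∀ {x u v : Γ}, B.φ x = 0 → ∀ {w : (mulCayley (S : Set Γ)).Walk u v}, B.InBox 1 w → B.InBox 1 (lmul S x w) := by
    intro x u v hx w hw z hz
    obtain ⟨z', hz', rfl⟩ := mem_support_lmul.1 hz
    rw [B.map_mul, hx, zero_add]; exact hw z' hz'
  suffices H : ∀ g : Γ, g ∈ Subgroup.closure (S : Set Γ) → ∃ w : (mulCayley (S : Set Γ)).Walk (1 : Γ) (B.proj g), B.InBox 1 w by
    obtain ⟨w, hw⟩ := H k (by rw [hS]; exact Subgroup.mem_top k)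
    exact ⟨w.copy rfl (B.proj_of_ker hk), fun z hz => hw z (by rwa [support_copy] at hz)⟩
  intro g hg
  induction hg using Subgroup.closure_induction with
  | mem s hs => exact B.exists_walk_proj_letter (Finset.mem_coe.1 hs)
  | one =>
      refine ⟨(Walk.nil : (mulCayley (S : Set Γ)).Walk (1 : Γ) 1).copy rfl (B.proj_of_ker B.φ_one).symm, fun z hz => ?_⟩
      rw [support_copy, support_nil, List.mem_singleton] at hz
      rw [hz, B.φ_one]; exact zero_mem_box 2 1
  | mul x y _ _ hx hy =>
      obtain ⟨wx, hwx⟩ := hx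
      obtain ⟨wy, hwy⟩ := hy
      refine ⟨(wx.append ((lmul S (B.proj x) wy).copy (mul_one _) rfl)).copy rfl (B.proj_mul_comm x y).symm, fun z hz => ?_⟩
      rw [support_copy, support_append, List.mem_append] at hz
      rcases hz with hz | hz
      · exact hwx z hz
      · have hz' : z ∈ (lmul S (B.proj x) wy).support := by
          have := List.tail_subset _ hz; rwa [support_copy] at this
        exact tr (B.φ_proj x) hwy z hz'
  | inv x _ hx =>
      obtain ⟨wx, hwx⟩ := hx
      refine ⟨(lmul S (B.proj x)⁻¹ wx.reverse).copy (inv_mul_cancel _) (by rw [mul_one, B.proj_inv_comm]), fun z hz => ?_⟩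
      rw [support_copy] at hz
      have h0 : B.φ (B.proj x)⁻¹ = 0 := by rw [B.φ_inv, B.φ_proj, neg_zero]
      exact tr h0 (fun z hz => hwx z ((mem_support_reverse_iff wx z).1 hz)) z hz

end CylBase

end CayCyl

/-! ## The abelian `CayleySign₂` -/

section Comm

open CayCyl

variable {Γ : Type} [CommGroup Γ] {S : Finset Γ}

/-- **`CayleySign₂` on an ABELIAN group** from: additive `φ` of unit range with unit steps, `S` symmetric and generating, ONE automorphism `κ`
permuting `S` with `φκ = (φ₀, −φ₁)` (`ν` := inversion; `C_1` connected by `CylBase.boxWalks_of_comm`). [cite: KozmaNitzan2024, §4 p. 16 (Lemma 8)] -/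
def CayleySign₂.ofComm (φ : Γ → Site 2) (map_mul : ∀ g h : Γ, φ (g * h) = φ g + φ h) (lip : ∀ s ∈ S, ∀ i : Fin 2, |φ s i| ≤ 1)
    (step : ∀ i : Fin 2, ∃ s ∈ S, φ s = Pi.single i 1) (symm : ∀ s, s⁻¹ ∈ S ↔ s ∈ S) (hS : Subgroup.closure (S : Set Γ) = ⊤)
    (κ : Γ ≃* Γ) (κ_mem : ∀ s, κ s ∈ S ↔ s ∈ S) (κ_φ : ∀ g, φ (κ g) = flipSnd (φ g)) : CayleySign₂ Γ S :=
  let B : CylBase Γ S :=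
    { φ := φ, map_mul := map_mul, lip := lip
      s₀ := Classical.choose (step 0), s₀_mem := (Classical.choose_spec (step 0)).1, φ_s₀ := (Classical.choose_spec (step 0)).2
      s₁ := Classical.choose (step 1), s₁_mem := (Classical.choose_spec (step 1)).1, φ_s₁ := (Classical.choose_spec (step 1)).2 }
  { φ := φ
    map_mul := map_mul
    lip := lip
    step := step
    ν := MulEquiv.inv Γ
    ν_mem := fun s => by rw [MulEquiv.inv_apply]; exact symm s
    ν_φ := fun g => by rw [MulEquiv.inv_apply]; exact B.φ_inv g
    cyl_one := (B.toCylData₂ 1 (B.boxWalks_of_comm hS)).cylG_connected_of_boxWalks (B.boxWalks_of_comm hS) le_rfl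
    κ := κ
    κ_mem := κ_mem
    κ_φ := κ_φ }

/-- **THEOREM (abelian groups, unconditional): `θ_g(p) = 0` for all `p ≤ p_c` on `Cay(Γ; S)`** for every abelian `Γ` and finite symmetric
generating `S` with an additive unit-range `φ : Γ → ℤ²` having unit steps in `S` and one `S`-preserving automorphism flipping `φ₁` —
no kernel-letter condition (compare `CayleySign.criticalContinuity_ofComm`).
builds on p205010 (kernel theorem, internal audit signed; external expert review pending). [cite: BenjaminiSchramm1996, Conj. 4; §2] -/
theorem CayleySign₂.theta_eq_zero_of_le_ofComm (φ : Γ → Site 2) (map_mul : ∀ g h : Γ, φ (g * h) = φ g + φ h)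
    (lip : ∀ s ∈ S, ∀ i : Fin 2, |φ s i| ≤ 1) (step : ∀ i : Fin 2, ∃ s ∈ S, φ s = Pi.single i 1) (symm : ∀ s, s⁻¹ ∈ S ↔ s ∈ S)
    (hS : Subgroup.closure (S : Set Γ) = ⊤) (κ : Γ ≃* Γ) (κ_mem : ∀ s, κ s ∈ S ↔ s ∈ S) (κ_φ : ∀ g, φ (κ g) = flipSnd (φ g))
    (g : Γ) {p : unitInterval} (hp : (p : ℝ) ≤ criticalProb (mulCayley (S : Set Γ)) g) : theta (mulCayley (S : Set Γ)) g p = 0 :=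
  (CayleySign₂.ofComm φ map_mul lip step symm hS κ κ_mem κ_φ).theta_eq_zero_of_le g hp

end Comm

end Summit.CriticalPhenomena.PercolationContinuityZ3.Theorems.Transplant

end
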